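import Summits.Ventures.HodgeRepro.RectQuadKK
import Summits.Ventures.HodgeRepro.RectQuad33

/-!
# The census witnesses of the fourth and fifth mechanisms as kernel corollaries

Blind re-derivation cell `pub-hodge-repro`, seat `p1` (gen 10).  The abelian census (P1.md §16b–§16f) found the
first instances of the two new mechanisms on four small groups that NONE of the three older mechanisms covers;
each is now a one-line corollary of the general theorems:

* `(C₂ × C₁₂, (0, 6))` — the involution rectangle at `k = 3` (`exists_rectQuad6`: `u = (1, 0)`, `w = (0, 4)`);
* `(C₂ × C₂₀, (0, 10))` — `k = 5` (`exists_rectQuad_odd`: `w = (0, 4)` of order `5`, `8 · 5 = 40 = |G|`);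
* `(C₂ × C₂₈, (0, 14))` — `k = 7` (`w = (0, 4)` of order `7`, `8 · 7 = 56 = |G|`);
* `(C₃ × C₁₂, (0, 6))` — the two-generator rectangle at `k = 3` (`exists_rectQuad33_of_elems`: `w₁ = (0, 8)`,
  `w₂ = (1, 4)` of order `3`, `w₂ ∉ ⟨w₁⟩`; `|G| = 36`).

Every hypothesis is decided; the groups are the typer's `Multiplicative (ZMod m × ZMod n)`.
-/

set_option autoImplicit false

open Finset
open scoped Pointwise

namespace HodgeRepro.CosetQuad

/-- `C₂ × C₁₂` as a multiplicative group. -/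
abbrev C2xC12 : Type := Multiplicative (ZMod 2 × ZMod 12)

/-- `C₂ × C₂₀`. -/
abbrev C2xC20 : Type := Multiplicative (ZMod 2 × ZMod 20)

/-- `C₂ × C₂₈`. -/
abbrev C2xC28 : Type := Multiplicative (ZMod 2 × ZMod 28)

/-- `C₃ × C₁₂`. -/
abbrev C3xC12 : Type := Multiplicative (ZMod 3 × ZMod 12)

/-- `(C₂ × C₁₂, (0,6))` carries the involution rectangle `{1, u, wc, uwc}` with `u = (1,0)`, `w = (0,4)`. -/
theorem exists_rectQuad_C2xC12 :
    ∃ Φ : Finset C2xC12, IsCMType (Multiplicative.ofAdd (0, 6)) Φ ∧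
      SumTwo (rectQuad Φ (Multiplicative.ofAdd (1, 0)) (Multiplicative.ofAdd (0, 4))
        (Multiplicative.ofAdd (0, 6))) ∧
      ∀ i j : Fin 4, rectQuad Φ (Multiplicative.ofAdd (1, 0)) (Multiplicative.ofAdd (0, 4))
        (Multiplicative.ofAdd (0, 6)) j ≠
        (Multiplicative.ofAdd (0, 6) : C2xC12) • rectQuad Φ (Multiplicative.ofAdd (1, 0))
          (Multiplicative.ofAdd (0, 4)) (Multiplicative.ofAdd (0, 6)) i :=
  exists_rectQuad6 (by decide) (by decide)
    ((orderOf_eq_iff (by norm_num)).2 (by decide)) (by decide) (by decide) (by decide) (by decide)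

/-- `(C₂ × C₂₀, (0,10))` carries the involution rectangle with `w = (0,4)` of order `5` (`|G| = 40 = 8 · 5`). -/
theorem exists_rectQuad_C2xC20 :
    ∃ Φ : Finset C2xC20, IsCMType (Multiplicative.ofAdd (0, 10)) Φ ∧
      SumTwo (rectQuad Φ (Multiplicative.ofAdd (1, 0)) (Multiplicative.ofAdd (0, 4))
        (Multiplicative.ofAdd (0, 10))) ∧
      ∀ i j : Fin 4, rectQuad Φ (Multiplicative.ofAdd (1, 0)) (Multiplicative.ofAdd (0, 4))
        (Multiplicative.ofAdd (0, 10)) j ≠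
        (Multiplicative.ofAdd (0, 10) : C2xC20) • rectQuad Φ (Multiplicative.ofAdd (1, 0))
          (Multiplicative.ofAdd (0, 4)) (Multiplicative.ofAdd (0, 10)) i :=
  exists_rectQuad_odd 5 (by decide) (by decide) ((orderOf_eq_iff (by norm_num)).2 (by decide)) (by decide)
    (by decide) (by decide) (by norm_num) (by decide) (by decide)

/-- `(C₂ × C₂₈, (0,14))` carries the involution rectangle with `w = (0,4)` of order `7` (`|G| = 56 = 8 · 7`). -/
theorem exists_rectQuad_C2xC28 :
    ∃ Φ : Finset C2xC28, IsCMType (Multiplicative.ofAdd (0, 14)) Φ ∧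
      SumTwo (rectQuad Φ (Multiplicative.ofAdd (1, 0)) (Multiplicative.ofAdd (0, 4))
        (Multiplicative.ofAdd (0, 14))) ∧
      ∀ i j : Fin 4, rectQuad Φ (Multiplicative.ofAdd (1, 0)) (Multiplicative.ofAdd (0, 4))
        (Multiplicative.ofAdd (0, 14)) j ≠
        (Multiplicative.ofAdd (0, 14) : C2xC28) • rectQuad Φ (Multiplicative.ofAdd (1, 0))
          (Multiplicative.ofAdd (0, 4)) (Multiplicative.ofAdd (0, 14)) i :=
  exists_rectQuad_odd 7 (by decide) (by decide) ((orderOf_eq_iff (by norm_num)).2 (by decide)) (by decide)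
    (by decide) (by decide) (by norm_num) (by decide) (by decide)

/-- `(C₃ × C₁₂, (0,6))` carries the two-generator rectangle `{1, cw₁, cw₂, w₁w₂}` with `w₁ = (0,8)`, `w₂ = (1,4)`
of order `3` (`|G| = 36`) — the first instance on a group with a unique involution and non-cyclic odd part. -/
theorem exists_rectQuad_C3xC12 :
    ∃ Φ : Finset C3xC12, IsCMType (Multiplicative.ofAdd (0, 6)) Φ ∧
      SumTwo (rectQuad33 Φ (Multiplicative.ofAdd (0, 8)) (Multiplicative.ofAdd (1, 4))
        (Multiplicative.ofAdd (0, 6))) ∧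
      ∀ i j : Fin 4, rectQuad33 Φ (Multiplicative.ofAdd (0, 8)) (Multiplicative.ofAdd (1, 4))
        (Multiplicative.ofAdd (0, 6)) j ≠
        (Multiplicative.ofAdd (0, 6) : C3xC12) • rectQuad33 Φ (Multiplicative.ofAdd (0, 8))
          (Multiplicative.ofAdd (1, 4)) (Multiplicative.ofAdd (0, 6)) i :=
  exists_rectQuad33_of_elems (by decide) ((orderOf_eq_iff (by norm_num)).2 (by decide))
    ((orderOf_eq_iff (by norm_num)).2 (by decide)) (by decide)
    (by
      rw [Subgroup.mem_zpowers_iff]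
      rintro ⟨k, hk⟩
      have h3 : (Multiplicative.ofAdd ((0, 8) : ZMod 3 × ZMod 12) : C3xC12) ^ 3 = 1 := by decide
      have : (Multiplicative.ofAdd ((0, 8) : ZMod 3 × ZMod 12) : C3xC12) ^ k =
          (Multiplicative.ofAdd ((0, 8) : ZMod 3 × ZMod 12) : C3xC12) ^ (k % 3) := by
        rw [← zpow_mod_orderOf, (orderOf_eq_iff (by norm_num)).2 ⟨h3, by decide⟩, Nat.cast_ofNat]
      rw [this] at hk
      have hk3 : k % 3 = 0 ∨ k % 3 = 1 ∨ k % 3 = 2 := by omega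
      rcases hk3 with h | h | h <;> rw [h] at hk <;> revert hk <;> decide)
    (by decide)

end HodgeRepro.CosetQuad
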